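import Summits.QuantumFields.YangMills.Theorems.UnitScaleTiltProp7LinearCorrectorT3
import Summits.QuantumFields.YangMills.Theorems.UnitScaleTiltProp7CentreHarmonicRegaugeSupCov
import HarnessLib

/-!
# Route `UnitScaleTilt`, crux K1 «MinimiserStabilityRegPr» (stmt-QuantumFields-19200), route-R E′ path (α′), row (E1-a) — THE FIXED-POINT ⇒ SLICE READING:
# if the pinned gauge function solves `ψ = L D‴ + L (N ψ)` (the output of ✓ `Prop7ExactCorrectorContractionGauge.exists_unique_exact_corrector_gauge_of_mapsTo`), then the corrected
# chart `D‴ + N ψ − D_Wψ` is EXACTLY `S_H`-gauged — `Δ_W(D*_W(·))(x) = 0` at every non-centre site `x` — and `ψ` vanishes on the centres: the (E1) clause of ✓p666280 by name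

Cell `ym3-torus`, width seat `ym3-torus-px12` (gen 4); ★ym-ust-19200-p1 g15 NAMER RECORD 2026-08-28 22:01:27Z «(E1-a) algebra [free hand]» (round 3 20:45:05Z «(E1-a) equivalence +
uniqueness [S; … first free px hand that says MINE]»; «px12 g4: MINE (E1-a) ALGEBRA» 22:0xZ); LOCATE = ★routeR-w3 g5 `LOCATE-E1-CONTRACTION-routeRw3g5.md` §1.  THEOREMS ONLY (0 `def`,
0 `sorry`); `--supports stmt-QuantumFields-19200 --as helper`, count-neutral.  YM₃ on T³ is a ladder rung (R3), not the Clay problem; nothing here claims the stub, the crux, d = 4 or the gap.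

THE POINT (LOCATE-E1 §1).  With `LinCorr(A) := φ_A − I(φ_A)` (`Δ_Wφ_A = D*_WA`, `I` = pinned `Δ_W`-biharmonic interpolation on the centres — the additive maps `I`, `L` of ✓p671932
`Prop7LinearCorrectorT3.exists_linCorr(_T3)`), every bond field satisfies `A − D_W LinCorr(A) ∈ S_H` (✓ `Prop7CentreHarmonicRegaugeSupCov.covLap_divB_regaugeCov_eq_zero_off` fed by the
potential and the interpolant), hence by ADDITIVITY of `L`:  `ψ = L D‴ + L(N ψ) = L(D‴ + N ψ)` ⇒ `(D‴ + N ψ) − D_Wψ ∈ S_H`.  In the (E1-e) knit `N ψ := chart((X‴)^{e^{−iψ}}) − D‴ + D_Wψ`, so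
the conclusion is the `S_H` clause of ✓p666280's (E1) row for the competitor's corrected chart; the pinning `ψ|_C = 0` is ✓p671932's conjunct (c).  The converse (slice ⇒ fixed point,
by uniqueness ✓p666045 ∕ ✓ `isInterp_unique`) is not needed by the knit and is not typed here.

WHAT IS PROVED (ns `…Theorems.Prop7ExactCorrectorSliceReading`).
§1 GENERIC (any ring `𝔸`, carrier `T : ι → Perm S`, units `U`, pins `C : Set S`; additive `I`, `L` with the two exported properties (a)₂ «`Δ_U²(Iφ) = 0` off `C`» and (d) «every `A` has a
potential `φ` with `L A = φ − I φ`»):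
* ★ `covLap_divB_sub_covD_linCorr_off` — `∀ A, ∀ x ∉ C, Δ_U(D*_U(A − D_U(L A)))(x) = 0`.
* ★ `slice_of_corrected_chart` — `Dχ = A − D_Uψ` bondwise and `ψ = L A` ⇒ `Dχ ∈ S_H`.
* ★★ `slice_of_fixedPoint` — `ψ = L D‴ + L Nψ` ⇒ `(D‴ + Nψ) − D_Uψ ∈ S_H`; `vanishes_of_fixedPoint` — with (c) «`L A` vanishes on `C`»: `ψ|_C = 0`.
§2 THE T³ READING (run `K` of a T³ family, `SU(2)` background `W`, `𝒰 := fun κ z => unitsField (toUField W) ⟨z, κ⟩`, pins `range (embIter k)`; `I L` with the properties EXACTLY as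
exported by ✓ `exists_linCorr_T3`): ★★★ `slice_of_fixedPoint_T3` — `ψ = L D‴ + L Nψ` ⇒ (i) `ψ (embIter k y) = 0` for every `y`, (ii) the (E1) clause of ✓p666280 VERBATIM for the bond field
`fun κ z => (D‴ κ z + Nψ κ z) − covD (torusT (F.P K) 0) 𝒰 κ ψ z`; ★★ `slice_of_corrected_chart_T3` — the same for `Dχ = A − D_Wψ`, `ψ = L A`.
HONEST SCOPE.  Algebra over landed files (additivity of `L`, the potential∕interpolant bookkeeping of ✓ `…RegaugeSupCov`); no estimate; the analytic rows of (E1) ((hK), (hK₂:=ρ₃), (E1-c)) are untouched.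

References: T. Bałaban, CMP 102 (1985) 277–309 [Balaban1985Variational] (Prop. 7 p.299, (141)–(143) p.299); CMP 99 (1985) 75–102 [Balaban1985RegularSpaces] ((1.14) p.78);
CMP 99 (1985) 389–434 [Balaban1985BackgroundPropagators] ((3.3) p.390, (3.8) p.392).
-/

set_option autoImplicit false

noncomputable section

open scoped BigOperators Matrix.Norms.L2Operator Matrix

namespace Summit.QuantumFields.YangMills.Theorems.Prop7ExactCorrectorSliceReading

open Literature.MathematicalPhysics.QuantumFieldTheory.Balaban1983to89
open B9Eq39Adjoint (R covD covDstar divB)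
open B9TorusCalculus (torusT)
open Summit.QuantumFields.YangMills.Theorems.Prop7CentreHarmonicRegaugeSupCov (covLap_divB_regaugeCov_eq_zero_off)

/-! ## §1 Generic carrier: the linearly corrected field lies in `S_H`; the fixed-point reading -/

section Generic

variable {𝔸 : Type*} [Ring 𝔸] {S : Type*} {ι : Type*} [Fintype ι] (T : ι → Equiv.Perm S) (U : ι → S → 𝔸ˣ)

/-- ★ **`A − D_U(LinCorr A) ∈ S_H`**: for additive `I L` with (a)₂ `Δ_U²(Iφ) = 0` off `C` and (d) «every `A` has a potential `φ` (`Δ_Uφ = D*_UA`) with `L A = φ − I φ`»: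
`Δ_U(D*_U(A − D_U(L A)))(x) = 0` for every `x ∉ C`. [cite: Balaban1985Variational, Prop. 7 p.299; Balaban1985BackgroundPropagators, (3.8) p.392] -/
theorem covLap_divB_sub_covD_linCorr_off (C : Set S) (I : (S → 𝔸) →+ (S → 𝔸)) (L : (ι → S → 𝔸) →+ (S → 𝔸))
    (hIbi : ∀ φ : S → 𝔸, ∀ x ∉ C,
      divB T U (fun μ => covD T U μ (fun y => divB T U (fun ν => covD T U ν (I φ)) y)) x = 0)
    (hLpot : ∀ A : ι → S → 𝔸, ∃ φ : S → 𝔸, (∀ x, divB T U (fun μ => covD T U μ φ) x = divB T U A x) ∧ L A = φ - I φ)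
    (A : ι → S → 𝔸) :
    ∀ x ∉ C, divB T U (fun μ z => covD T U μ (fun y => divB T U (fun ν w => A ν w - covD T U ν (L A) w) y) z) x = 0 := by
  obtain ⟨φ, hφ, hL⟩ := hLpot A
  have hLfun : (L A : S → 𝔸) = fun y' => φ y' - I φ y' := by rw [hL]; rfl
  rw [hLfun]
  exact covLap_divB_regaugeCov_eq_zero_off T U C A φ (I φ) (fun x => hφ x) (fun x hx => hIbi φ x hx)

/-- ★ **THE CORRECTED CHART LIES IN `S_H`**: if `Dχ = A − D_Uψ` bondwise and `ψ = L A`, then `Δ_U(D*_U Dχ)(x) = 0` off `C`. [cite: Balaban1985Variational, Prop. 7 p.299] -/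
theorem slice_of_corrected_chart (C : Set S) (I : (S → 𝔸) →+ (S → 𝔸)) (L : (ι → S → 𝔸) →+ (S → 𝔸))
    (hIbi : ∀ φ : S → 𝔸, ∀ x ∉ C,
      divB T U (fun μ => covD T U μ (fun y => divB T U (fun ν => covD T U ν (I φ)) y)) x = 0)
    (hLpot : ∀ A : ι → S → 𝔸, ∃ φ : S → 𝔸, (∀ x, divB T U (fun μ => covD T U μ φ) x = divB T U A x) ∧ L A = φ - I φ)
    (A Dχ : ι → S → 𝔸) (ψ : S → 𝔸) (hχ : ∀ ν w, Dχ ν w = A ν w - covD T U ν ψ w) (hψ : ψ = L A) :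
    ∀ x ∉ C, divB T U (fun μ z => covD T U μ (fun y => divB T U Dχ y) z) x = 0 := by
  have hfun : Dχ = fun ν w => A ν w - covD T U ν (L A) w := by
    funext ν w; rw [hχ, hψ]
  rw [hfun]
  exact covLap_divB_sub_covD_linCorr_off T U C I L hIbi hLpot A

/-- ★★ **FIXED POINT ⇒ SLICE**: if `ψ = L D‴ + L Nψ` then the corrected chart `(D‴ + Nψ) − D_Uψ` satisfies `Δ_U(D*_U(·))(x) = 0` at every `x ∉ C`.
[cite: Balaban1985Variational, Prop. 7 p.299, (141)-(143) p.299] -/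
theorem slice_of_fixedPoint (C : Set S) (I : (S → 𝔸) →+ (S → 𝔸)) (L : (ι → S → 𝔸) →+ (S → 𝔸))
    (hIbi : ∀ φ : S → 𝔸, ∀ x ∉ C,
      divB T U (fun μ => covD T U μ (fun y => divB T U (fun ν => covD T U ν (I φ)) y)) x = 0)
    (hLpot : ∀ A : ι → S → 𝔸, ∃ φ : S → 𝔸, (∀ x, divB T U (fun μ => covD T U μ φ) x = divB T U A x) ∧ L A = φ - I φ)
    (D₃ Nψ : ι → S → 𝔸) (ψ : S → 𝔸) (hfix : ψ = L D₃ + L Nψ) :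
    ∀ x ∉ C, divB T U (fun μ z => covD T U μ (fun y => divB T U (fun ν w => (D₃ ν w + Nψ ν w) - covD T U ν ψ w) y) z) x = 0 := by
  have hψ : ψ = L (D₃ + Nψ) := by rw [map_add]; exact hfix
  exact slice_of_corrected_chart T U C I L hIbi hLpot (D₃ + Nψ) _ ψ (fun ν w => rfl) hψ

omit [Fintype ι] in
/-- **THE FIXED POINT IS PINNED**: with (c) «`L A` vanishes on `C`», `ψ = L D‴ + L Nψ` vanishes on `C`. [cite: Balaban1985RegularSpaces, (1.14) p.78] -/
theorem vanishes_of_fixedPoint (C : Set S) (L : (ι → S → 𝔸) →+ (S → 𝔸)) (hLC : ∀ A, ∀ y ∈ C, L A y = 0)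
    (D₃ Nψ : ι → S → 𝔸) (ψ : S → 𝔸) (hfix : ψ = L D₃ + L Nψ) :
    ∀ y ∈ C, ψ y = 0 := by
  intro y hy
  rw [hfix, ← map_add]
  exact hLC _ y hy

end Generic

/-! ## §2 The T³ reading in the letters of ✓p666280's (E1) row -/

section T3

open Literature.MathematicalPhysics.QuantumFieldTheory.Balaban1983to89.T3ContinuumYM3Torus
open B10Eq27TorusAxialLog (unitsField toUField)
open B15DeterminingSets (embIter)

variable (F : T3Family) (K k : ℕ) (W : GaugeField (F.P K) 0 (Matrix.specialUnitaryGroup (Fin 2) ℂ))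

/-- ★★★ **FIXED POINT ⇒ THE (E1) SLICE CLAUSE, T³ MEMBER.**  Run `K` of a T³ family, `SU(2)` background `W` (`𝒰 := fun κ z => unitsField (toUField W) ⟨z, κ⟩`), pins `ι_k(T^{(k)})`;
additive `I L` with the three properties exported by ✓ `Prop7LinearCorrectorT3.exists_linCorr_T3` ((a)₂ biharmonicity of `I φ` off the centres, (c) `L A (ι_k y) = 0`, (d) potentials with
`L A = φ − I φ`).  If `ψ = L D‴ + L Nψ` then (i) `ψ (ι_k y) = 0` for every `y`, and (ii) the corrected chart `fun κ z => (D‴ κ z + Nψ κ z) − (D_Wψ) κ z` satisfies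
`Δ_W(D*_W(·))(x) = 0` for every `x ∉ range ι_k` — the (E1) clause of ✓ `Prop7PV3EOfPinnedSliceAndZetaRow.stub_PV3E_of_pinnedSliceAndZetaRow` by name (at `k := K − n`).
[cite: Balaban1985Variational, Prop. 7 p.299, (141)-(143) p.299; Balaban1985RegularSpaces, (1.14) p.78; Balaban1985BackgroundPropagators, (3.8) p.392] -/
theorem slice_of_fixedPoint_T3
    (I : (Site (F.P K) 0 → Matrix (Fin 2) (Fin 2) ℂ) →+ (Site (F.P K) 0 → Matrix (Fin 2) (Fin 2) ℂ))
    (L : (Fin (F.P K).d → Site (F.P K) 0 → Matrix (Fin 2) (Fin 2) ℂ) →+ (Site (F.P K) 0 → Matrix (Fin 2) (Fin 2) ℂ))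
    (hIbi : ∀ φ, ∀ x : Site (F.P K) 0, x ∉ Set.range (embIter k) →
      divB (torusT (F.P K) 0) (fun κ z => unitsField (toUField W) ⟨z, κ⟩)
        (fun μ => covD (torusT (F.P K) 0) (fun κ z => unitsField (toUField W) ⟨z, κ⟩) μ
          (fun y => divB (torusT (F.P K) 0) (fun κ z => unitsField (toUField W) ⟨z, κ⟩)
            (fun ν => covD (torusT (F.P K) 0) (fun κ z => unitsField (toUField W) ⟨z, κ⟩) ν (I φ)) y)) x = 0)
    (hLC : ∀ (A) (y : Site (F.P K) k), L A (embIter k y) = 0)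
    (hLpot : ∀ A, ∃ φ, (∀ x, divB (torusT (F.P K) 0) (fun κ z => unitsField (toUField W) ⟨z, κ⟩)
        (fun μ => covD (torusT (F.P K) 0) (fun κ z => unitsField (toUField W) ⟨z, κ⟩) μ φ) x
      = divB (torusT (F.P K) 0) (fun κ z => unitsField (toUField W) ⟨z, κ⟩) A x) ∧ L A = φ - I φ)
    (D₃ Nψ : Fin (F.P K).d → Site (F.P K) 0 → Matrix (Fin 2) (Fin 2) ℂ) (ψ : Site (F.P K) 0 → Matrix (Fin 2) (Fin 2) ℂ)
    (hfix : ψ = L D₃ + L Nψ) :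
    (∀ y : Site (F.P K) k, ψ (embIter k y) = 0) ∧
    (∀ x : Site (F.P K) 0, x ∉ Set.range (embIter k) →
      divB (torusT (F.P K) 0) (fun κ z => unitsField (toUField W) ⟨z, κ⟩)
        (fun μ z => covD (torusT (F.P K) 0) (fun κ z => unitsField (toUField W) ⟨z, κ⟩) μ
          (fun y => divB (torusT (F.P K) 0) (fun κ z => unitsField (toUField W) ⟨z, κ⟩)
            (fun κ z => (D₃ κ z + Nψ κ z) - covD (torusT (F.P K) 0) (fun κ z => unitsField (toUField W) ⟨z, κ⟩) κ ψ z) y) z) x = 0) := by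
  refine ⟨fun y => ?_, fun x hx => ?_⟩
  · exact vanishes_of_fixedPoint (Set.range (embIter (P := F.P K) k)) L (fun A y' hy' => by
      obtain ⟨y, rfl⟩ := hy'; exact hLC A y) D₃ Nψ ψ hfix _ ⟨y, rfl⟩
  · exact slice_of_fixedPoint (torusT (F.P K) 0) (fun κ z => unitsField (toUField W) ⟨z, κ⟩) (Set.range (embIter (P := F.P K) k)) I L
      hIbi hLpot D₃ Nψ ψ hfix x hx

/-- ★★ **THE CORRECTED CHART IS IN THE SLICE, T³ MEMBER** (the `N`-free form the knit may prefer: `A := chart(Y) + D_Wψ`): if `Dχ = A − D_Wψ` bondwise and `ψ = L A` then `ψ` is pinned on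
`ι_k(T^{(k)})` and `Δ_W(D*_W Dχ)(x) = 0` for every `x ∉ range ι_k`. [cite: Balaban1985Variational, Prop. 7 p.299; Balaban1985RegularSpaces, (1.14) p.78] -/
theorem slice_of_corrected_chart_T3
    (I : (Site (F.P K) 0 → Matrix (Fin 2) (Fin 2) ℂ) →+ (Site (F.P K) 0 → Matrix (Fin 2) (Fin 2) ℂ))
    (L : (Fin (F.P K).d → Site (F.P K) 0 → Matrix (Fin 2) (Fin 2) ℂ) →+ (Site (F.P K) 0 → Matrix (Fin 2) (Fin 2) ℂ))
    (hIbi : ∀ φ, ∀ x : Site (F.P K) 0, x ∉ Set.range (embIter k) →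
      divB (torusT (F.P K) 0) (fun κ z => unitsField (toUField W) ⟨z, κ⟩)
        (fun μ => covD (torusT (F.P K) 0) (fun κ z => unitsField (toUField W) ⟨z, κ⟩) μ
          (fun y => divB (torusT (F.P K) 0) (fun κ z => unitsField (toUField W) ⟨z, κ⟩)
            (fun ν => covD (torusT (F.P K) 0) (fun κ z => unitsField (toUField W) ⟨z, κ⟩) ν (I φ)) y)) x = 0)
    (hLC : ∀ (A) (y : Site (F.P K) k), L A (embIter k y) = 0)
    (hLpot : ∀ A, ∃ φ, (∀ x, divB (torusT (F.P K) 0) (fun κ z => unitsField (toUField W) ⟨z, κ⟩)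
        (fun μ => covD (torusT (F.P K) 0) (fun κ z => unitsField (toUField W) ⟨z, κ⟩) μ φ) x
      = divB (torusT (F.P K) 0) (fun κ z => unitsField (toUField W) ⟨z, κ⟩) A x) ∧ L A = φ - I φ)
    (A Dχ : Fin (F.P K).d → Site (F.P K) 0 → Matrix (Fin 2) (Fin 2) ℂ) (ψ : Site (F.P K) 0 → Matrix (Fin 2) (Fin 2) ℂ)
    (hχ : ∀ ν w, Dχ ν w = A ν w - covD (torusT (F.P K) 0) (fun κ z => unitsField (toUField W) ⟨z, κ⟩) ν ψ w) (hψ : ψ = L A) :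
    (∀ y : Site (F.P K) k, ψ (embIter k y) = 0) ∧
    (∀ x : Site (F.P K) 0, x ∉ Set.range (embIter k) →
      divB (torusT (F.P K) 0) (fun κ z => unitsField (toUField W) ⟨z, κ⟩)
        (fun μ z => covD (torusT (F.P K) 0) (fun κ z => unitsField (toUField W) ⟨z, κ⟩) μ
          (fun y => divB (torusT (F.P K) 0) (fun κ z => unitsField (toUField W) ⟨z, κ⟩) Dχ y) z) x = 0) := by
  refine ⟨fun y => ?_, fun x hx => ?_⟩
  · rw [hψ]; exact hLC A y
  · exact slice_of_corrected_chart (torusT (F.P K) 0) (fun κ z => unitsField (toUField W) ⟨z, κ⟩) (Set.range (embIter (P := F.P K) k)) I L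
      hIbi hLpot A Dχ ψ hχ hψ x hx

end T3

end Summit.QuantumFields.YangMills.Theorems.Prop7ExactCorrectorSliceReading

end
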